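import Summits.KontsevichZagierPeriods.KontsevichZagierPeriods.Theses.DefinableMoves
import Literature.NumberTheory.Transcendental.KZProductIdeal

/-!
# Birth skeleton — crux `DefinableMoves.RealPiCancellation` (stmt-KontsevichZagierPeriods-17880), line `transfer`

Two registered stubs and the kernel-checked composition `RealPiCancellation_of`.

* `stub_transfer` — item stmt-KontsevichZagierPeriods-4088 `DefinableMoves.Transfer` BY NAME (the route's
  lever: an `ℝ`-chain between `ℚ`-combinations can be replaced by a `ℚ`-chain; Tarski–Seidenberg +
  `IntegrabilityLocus`).
* `stub_piCancellation` — `KZ.PiCancellation` (closed form of item stmt-KontsevichZagierPeriods-0540,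
  `AyoubSpecialisation.AyoubPiCancellation ↔ KZ.PiCancellation` is the tree theorem
  `BetaCancellationLine.stub_ayoubBridge`).

Composition: a real certificate for `[π] ⋆ c` is pulled back to a `ℚ`-certificate by `Transfer`
(`toRaw ∘ bc = incl`), `[π]` is cancelled over `ℚ`, and the result is base-changed to `ℝ`.
This is the "transfer line": it shows `RealPiCancellation ⟸ 4088 ∧ 0540`; the converse direction
`Transfer → RealPiCancellation → KZ.PiCancellation` also holds (Cruxes/RealKZ/PiSplit.lean), so GIVEN
Transfer the crux is exactly item 0540. A real-data proof NOT passing through 0540 would have to exploit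
the real automorphisms of the move sets (rescalings) or fibrewise specialisation at real points — no
such line is registered yet.
-/

noncomputable section

open Literature.NumberTheory.Transcendental
open Summit.KontsevichZagierPeriods.KontsevichZagierPeriods.Theses
open Summit.KontsevichZagierPeriods.KontsevichZagierPeriods.Theses.DefinableMoves

namespace Summit.KontsevichZagierPeriods.KontsevichZagierPeriods.Cruxes.RealPiCancellation.TransferLine

/-- Stub 1 = item stmt-KontsevichZagierPeriods-4088 by name. -/
theorem stub_transfer : DefinableMoves.Transfer := by
  sorry

/-- Stub 2 = `KZ.PiCancellation` (item stmt-KontsevichZagierPeriods-0540 in closed form). -/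
theorem stub_piCancellation : KZ.PiCancellation := by
  sorry

/-- The real base change `KZ.FormalRep →+ KZOver.FormalRep ℝ`. -/
def bc : KZ.FormalRep →+ KZOver.FormalRep ℝ :=
  (KZOver.baseChange ℚ ℝ).comp KZOver.equivKZ.toAddMonoidHom

theorem bc_of {n : ℕ} (r : KZ.IntegralRep n) :
    bc (KZ.of r) = KZOver.of (KZOver.IntegralRep.ofKZOver ℝ r) := rfl

theorem bc_mem_relations {c : KZ.FormalRep} (hc : c ∈ KZ.relations) : bc c ∈ KZOver.relations ℝ :=
  KZOver.baseChange_mem_relations ℝ ((KZOver.equivKZ_mem_relations_iff c).mpr hc)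

theorem toRaw_comp_bc :
    KZOver.toRaw.comp bc =
      FreeAbelianGroup.map (fun x : (Σ n, KZ.IntegralRep n) => (⟨x.1, (x.2.domain, x.2.integrand)⟩ :
        Σ n : ℕ, Set (Fin n → ℝ) × ((Fin n → ℝ) → ℝ))) := by
  refine FreeAbelianGroup.lift_ext _ _ fun ⟨n, r⟩ => ?_
  simp only [AddMonoidHom.coe_comp, Function.comp_apply]
  change KZOver.toRaw (bc (KZ.of r)) = _
  rw [bc_of, KZOver.toRaw_of]
  rfl

/-- `Transfer` read on `bc`. -/
theorem transfer_bc (hT : DefinableMoves.Transfer) {c : KZ.FormalRep}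
    (hc : bc c ∈ KZOver.relations ℝ) : c ∈ KZ.relations := by
  rw [KZOver.mem_relations_iff_toRaw_mem, ← AddMonoidHom.comp_apply, toRaw_comp_bc] at hc
  exact hT c hc

/-- **Composition** (kernel-checked, no sorry outside the stubs):
`Transfer → KZ.PiCancellation → RealPiCancellation` — a real certificate for `[π] * c` is pulled back
to a `ℚ`-certificate by `Transfer` (`toRaw ∘ bc = incl`), `[π]` is cancelled over `ℚ`, and the result
is base-changed to `ℝ`. -/
theorem RealPiCancellation_of :
    DefinableMoves.Transfer → KZ.PiCancellation → DefinableMoves.RealPiCancellation := by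
  intro hT hC c hc
  exact bc_mem_relations (hC c (transfer_bc hT hc))

/-- The crux from the two stubs. -/
theorem realPiCancellation_holds_of_stubs : DefinableMoves.RealPiCancellation :=
  RealPiCancellation_of stub_transfer stub_piCancellation

end Summit.KontsevichZagierPeriods.KontsevichZagierPeriods.Cruxes.RealPiCancellation.TransferLine
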